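import Summits.ABC.ABC.Theorems.PrimePowerRadical.Negative.Orders
import Summits.ABC.ABC.Theorems.PrimePowerRadical.Negative.DoubleWall
import Summits.ABC.ABC.Theorems.PrimePowerRadical.Negative.LinearLoss
import Summits.ABC.ABC.Theorems.IneffectiveSubspacePrimePowerRadicalStubAtomTendstoZero
import Summits.ABC.ABC.Theorems.IneffectiveSubspacePrimePowerRadicalStubPPRAtIffLevelAverage

/-!
# The lever of line `Sketch`: `T_q < ∞ ⟹` Wieferich sparsity at the prime base `q`

Stub `stub_wieferichSparse_of_wdc` of the line `Sketch` (card `adelic-brjuno-summability`) for the crux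
`Summit.ABC.ABC.Theses.IneffectiveSubspace.PrimePowerRadical` (stmt-ABC-1648).

Notation: `W_p := wieferichLevel q p`, `d_p := ordMod q p`, `E_W(q,k) := oddWieferichExcess q k`, and the
renormalised `p`-adic Brjuno atom `c_p := (W_p − 1)·log p / d_p` (inlined everywhere below; no definition is
introduced). `T_q := Σ_p c_p`.

PROVED (`stub_wieferichSparse_of_wdc`): if `q` is prime and `Σ_p c_p` is summable over the primes, then
`∀ ε > 0 ∃ C > 0 ∀ k ≥ 1, E_W(q,k) < C · q^{εk}`.

Proof (dominated convergence / `M`-splitting). The odd primes `p ∣ q^k − 1` are exactly those with `d_p ∣ k`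
(`Negative.dvd_pow_sub_one_iff_ordMod_dvd`), and `log E_W(q,k) = Σ_{p odd ∣ q^k−1} (W_p − 1) log p = Σ c_p·d_p`
(`lav_log_oddWieferichExcess_eq` of the sibling stub file, `lever_summand_eq_atom_mul`). Split the primes at `d_p·M ≤ k` (these contribute
`≤ (k/M)·T_q`) versus `d_p·M > k`: once `k ≥ K₀ := M·(sup_F d + 1)` the latter lie outside the finite vanishing set
`F` of the summable family (`summable_iff_vanishing_norm`) and, since `d_p ≤ k`, contribute `≤ k·c`. Choosing `M` with
`T_q/M ≤ c := ε·log q/2` gives `log E_W(q,k) ≤ ε k log q` for `k ≥ K₀`; a constant absorbs the finitely many `k < K₀`.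

Sources: card `adelic-brjuno-summability` (crux stmt-ABC-1648, line `Sketch`); ported from
`Cruxes/PrimePowerRadical/SketchIdeator2g2.lean` (`summand_eq_atom_mul`, `wieferichSparse_of_wdc`) onto the landed
`Negative.*` vocabulary; `atz_atom_nonneg` and `lav_log_oddWieferichExcess_eq` come from the sibling stub files.
NOT here: the summability hypothesis itself (`stub_wdc`, open), the converse direction (atoms `→ 0`), Romanoff.
-/

noncomputable section

-- `Summit.<Summit>.<Problem>` is the mandated summit-side namespace (CONVENTIONS §2); for the
-- single-conjunct summit `ABC` the two coincide, so the duplicate `ABC.ABC` is deliberate.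
set_option linter.dupNamespace false

namespace Summit.ABC.ABC.Theorems.PrimePowerRadical.Brjuno

open Literature.NumberTheory.DiophantineGeometry UniqueFactorizationMonoid
open Summit.ABC.ABC.Theses.IneffectiveSubspace
open Summit.ABC.ABC.Theorems.PrimePowerRadical.Negative
open scoped BigOperators

/-- For a prime `p ∣ q^k − 1` (`q ≥ 2`, `k ≥ 1`): the summand `(W_p − 1)·log p` equals `atom · ord_p(q)`. -/
theorem lever_summand_eq_atom_mul {q k p : ℕ} (hq : 2 ≤ q) (hk : 1 ≤ k) (hp : p.Prime)
    (hpk : p ∣ q ^ k - 1) :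
    ((wieferichLevel q p - 1 : ℕ) : ℝ) * Real.log p =
      ((wieferichLevel q p - 1 : ℕ) : ℝ) * Real.log p / (ordMod q p : ℝ) * (ordMod q p : ℝ) := by
  have hpq : ¬ p ∣ q := not_dvd_base_of_dvd hp hk (by omega) hpk
  have hd : 0 < ordMod q p := ordMod_pos hp hpq
  have hd0 : (ordMod q p : ℝ) ≠ 0 := by exact_mod_cast hd.ne'
  rw [div_mul_cancel₀ _ hd0]

/-- **The lever** (`stub_wieferichSparse_of_wdc`): `T_q < ∞ ⟹` Wieferich sparsity at the prime base `q`.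
If `Σ_p (W_p(q) − 1)·log p / ord_p(q)` is summable over the primes, then
`∀ ε > 0 ∃ C > 0 ∀ k ≥ 1, E_W(q,k) < C · q^{εk}` (dominated convergence / `M`-splitting). -/
theorem stub_wieferichSparse_of_wdc {q : ℕ} (hq : q.Prime)
    (h : Summable (fun p : Nat.Primes =>
      ((wieferichLevel q p - 1 : ℕ) : ℝ) * Real.log p / (ordMod q p : ℝ))) :
    ∀ ε : ℝ, 0 < ε → ∃ C : ℝ, 0 < C ∧ ∀ k : ℕ, 1 ≤ k →
      (oddWieferichExcess q k : ℝ) < C * (q : ℝ) ^ (ε * k) := by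
  have hq2 := hq.two_le
  have hq0 : (0 : ℝ) < q := by exact_mod_cast hq.pos
  have hq1 : (1 : ℝ) < q := by exact_mod_cast hq.one_lt
  have hlogq : 0 < Real.log q := Real.log_pos hq1
  -- the atom, as a function on `ℕ`
  set a : ℕ → ℝ := fun p => ((wieferichLevel q p - 1 : ℕ) : ℝ) * Real.log p / (ordMod q p : ℝ)
    with ha
  have ha0 : ∀ p, 0 ≤ a p := fun p => atz_atom_nonneg q p
  -- transport the summable function to `ℕ` via the indicator of the primes
  set G : ℕ → ℝ := (setOf Nat.Prime).indicator a with hG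
  have hGsum : Summable G := by
    rw [hG, ← summable_subtype_iff_indicator]
    exact h
  have hG0 : ∀ n, 0 ≤ G n := by
    intro n
    exact Set.indicator_nonneg (fun i _ => ha0 i) n
  have hGp : ∀ p : ℕ, p.Prime → G p = a p := by
    intro p hp
    exact Set.indicator_of_mem (show p ∈ setOf Nat.Prime from hp) _
  set T : ℝ := ∑' n, G n
  intro δ hδ
  -- the two halves of the budget
  set c : ℝ := δ * Real.log q / 2 with hc
  have hc0 : 0 < c := by positivity
  -- choose `M` with `T / M ≤ c`
  set M : ℕ := ⌈T / c⌉₊ + 1 with hM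
  have hMpos : 0 < M := by omega
  have hMR : (0 : ℝ) < M := by exact_mod_cast hMpos
  have hTM : T / M ≤ c := by
    rw [div_le_iff₀ hMR]
    have h1 : T / c ≤ ⌈T / c⌉₊ := Nat.le_ceil _
    have h2 : (⌈T / c⌉₊ : ℝ) ≤ M := by rw [hM]; push_cast; linarith
    have h3 : T / c ≤ M := le_trans h1 h2
    rw [div_le_iff₀ hc0] at h3
    linarith
  -- vanishing set for the tail
  obtain ⟨F, hF⟩ := summable_iff_vanishing_norm.mp hGsum c hc0
  set y₀ : ℕ := F.sup (ordMod q) + 1 with hy₀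
  set K₀ : ℕ := M * y₀ with hK₀
  -- core estimate for `k ≥ K₀`
  have core : ∀ k : ℕ, 1 ≤ k → K₀ ≤ k →
      Real.log (oddWieferichExcess q k) ≤ δ * k * Real.log q := by
    intro k hk hkK
    set S := (q ^ k - 1).primeFactors.erase 2 with hS
    have hmemS : ∀ p ∈ S, p.Prime ∧ p ∣ q ^ k - 1 ∧ ¬ p ∣ q := by
      intro p hp
      have hpP := Finset.mem_of_mem_erase hp
      have hpr : p.Prime := Nat.prime_of_mem_primeFactors hpP
      have hpk : p ∣ q ^ k - 1 := Nat.dvd_of_mem_primeFactors hpP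
      exact ⟨hpr, hpk, not_dvd_base_of_dvd hpr hk (by omega) hpk⟩
    have hdvdk : ∀ p ∈ S, ordMod q p ∣ k := by
      intro p hp
      obtain ⟨hpr, hpk, -⟩ := hmemS p hp
      exact (dvd_pow_sub_one_iff_ordMod_dvd hpr (by omega) k).mp hpk
    rw [lav_log_oddWieferichExcess_eq, ← hS]
    -- rewrite summands as `atom * ord`
    have hre : ∑ p ∈ S, ((wieferichLevel q p - 1 : ℕ) : ℝ) * Real.log p
        = ∑ p ∈ S, a p * (ordMod q p : ℝ) := by
      apply Finset.sum_congr rfl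
      intro p hp
      obtain ⟨hpr, hpk, -⟩ := hmemS p hp
      rw [ha]
      exact lever_summand_eq_atom_mul hq2 hk hpr hpk
    rw [hre]
    -- split at `ord * M ≤ k`
    rw [← Finset.sum_filter_add_sum_filter_not S (fun p => ordMod q p * M ≤ k)]
    set S₁ := S.filter (fun p => ordMod q p * M ≤ k)
    set S₂ := S.filter (fun p => ¬ ordMod q p * M ≤ k)
    -- first block
    have hB1 : ∑ p ∈ S₁, a p * (ordMod q p : ℝ) ≤ (k : ℝ) / M * T := by
      have h1 : ∑ p ∈ S₁, a p * (ordMod q p : ℝ) ≤ ∑ p ∈ S₁, a p * ((k : ℝ) / M) := by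
        apply Finset.sum_le_sum
        intro p hp
        have hpd : ordMod q p * M ≤ k := (Finset.mem_filter.mp hp).2
        have hpd' : (ordMod q p : ℝ) ≤ (k : ℝ) / M := by
          rw [le_div_iff₀ hMR]
          exact_mod_cast hpd
        exact mul_le_mul_of_nonneg_left hpd' (ha0 p)
      have h2 : ∑ p ∈ S₁, a p * ((k : ℝ) / M) = ((k : ℝ) / M) * ∑ p ∈ S₁, a p := by
        rw [Finset.mul_sum]
        apply Finset.sum_congr rfl
        intro p _
        ring
      have h3 : ∑ p ∈ S₁, a p = ∑ p ∈ S₁, G p := by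
        apply Finset.sum_congr rfl
        intro p hp
        rw [hGp p (hmemS p (Finset.mem_filter.mp hp).1).1]
      have h4 : ∑ p ∈ S₁, G p ≤ T := hGsum.sum_le_tsum S₁ (fun i _ => hG0 i)
      have hkM : 0 ≤ (k : ℝ) / M := by positivity
      calc ∑ p ∈ S₁, a p * (ordMod q p : ℝ)
          ≤ ∑ p ∈ S₁, a p * ((k : ℝ) / M) := h1
        _ = ((k : ℝ) / M) * ∑ p ∈ S₁, a p := h2
        _ = ((k : ℝ) / M) * ∑ p ∈ S₁, G p := by rw [h3]
        _ ≤ ((k : ℝ) / M) * T := mul_le_mul_of_nonneg_left h4 hkM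
        _ = (k : ℝ) / M * T := rfl
    -- second block: disjoint from `F`, orders `≤ k`
    have hdisj : Disjoint S₂ F := by
      rw [Finset.disjoint_left]
      intro p hp2 hpF
      have hnot : ¬ ordMod q p * M ≤ k := (Finset.mem_filter.mp hp2).2
      have hle : ordMod q p ≤ F.sup (ordMod q) := Finset.le_sup hpF
      apply hnot
      calc ordMod q p * M ≤ F.sup (ordMod q) * M := Nat.mul_le_mul_right _ hle
        _ ≤ y₀ * M := Nat.mul_le_mul_right _ (by omega)
        _ = K₀ := by rw [hK₀, mul_comm]
        _ ≤ k := hkK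
    have hB2 : ∑ p ∈ S₂, a p * (ordMod q p : ℝ) ≤ (k : ℝ) * c := by
      have h1 : ∑ p ∈ S₂, a p * (ordMod q p : ℝ) ≤ ∑ p ∈ S₂, a p * (k : ℝ) := by
        apply Finset.sum_le_sum
        intro p hp
        have hpS : p ∈ S := (Finset.mem_filter.mp hp).1
        have hdk : ordMod q p ≤ k := Nat.le_of_dvd (by omega) (hdvdk p hpS)
        have hdk' : (ordMod q p : ℝ) ≤ k := by exact_mod_cast hdk
        exact mul_le_mul_of_nonneg_left hdk' (ha0 p)
      have h2 : ∑ p ∈ S₂, a p * (k : ℝ) = (k : ℝ) * ∑ p ∈ S₂, G p := by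
        rw [Finset.mul_sum]
        apply Finset.sum_congr rfl
        intro p hp
        rw [hGp p (hmemS p (Finset.mem_filter.mp hp).1).1]
        ring
      have h3 : ∑ p ∈ S₂, G p ≤ c := by
        have := hF S₂ hdisj
        rw [Real.norm_eq_abs] at this
        have := (abs_lt.mp this).2
        linarith
      have hk0 : (0 : ℝ) ≤ k := Nat.cast_nonneg _
      calc ∑ p ∈ S₂, a p * (ordMod q p : ℝ)
          ≤ ∑ p ∈ S₂, a p * (k : ℝ) := h1
        _ = (k : ℝ) * ∑ p ∈ S₂, G p := h2
        _ ≤ (k : ℝ) * c := mul_le_mul_of_nonneg_left h3 hk0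
    -- combine
    have hk0 : (0 : ℝ) ≤ k := Nat.cast_nonneg _
    have hB1' : (k : ℝ) / M * T ≤ (k : ℝ) * c := by
      have : (k : ℝ) / M * T = (k : ℝ) * (T / M) := by ring
      rw [this]
      exact mul_le_mul_of_nonneg_left hTM hk0
    calc ∑ p ∈ S₁, a p * (ordMod q p : ℝ) + ∑ p ∈ S₂, a p * (ordMod q p : ℝ)
        ≤ (k : ℝ) * c + (k : ℝ) * c := add_le_add (le_trans hB1 hB1') hB2
      _ = δ * k * Real.log q := by rw [hc]; ring
  -- assemble the constant
  set B : ℝ := (∑ j ∈ Finset.range K₀, (oddWieferichExcess q j : ℝ)) + 2 with hB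
  have hBsum0 : 0 ≤ ∑ j ∈ Finset.range K₀, (oddWieferichExcess q j : ℝ) :=
    Finset.sum_nonneg fun j _ => Nat.cast_nonneg _
  have hB1 : 1 < B := by rw [hB]; linarith
  have hB0 : 0 < B := by linarith
  refine ⟨B, hB0, fun k hk => ?_⟩
  have hQ1 : (1 : ℝ) ≤ (q : ℝ) ^ (δ * k) := Real.one_le_rpow hq1.le (by positivity)
  have hQ0 : (0 : ℝ) < (q : ℝ) ^ (δ * k) := by positivity
  by_cases hkK : K₀ ≤ k
  · -- large `k`: `E_W ≤ q^(δ k) < B q^(δ k)`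
    have hE0 : (0 : ℝ) < oddWieferichExcess q k := by exact_mod_cast oddWieferichExcess_pos q k
    have hlog := core k hk hkK
    have hE : (oddWieferichExcess q k : ℝ) ≤ (q : ℝ) ^ (δ * k) := by
      have h1 : (oddWieferichExcess q k : ℝ) = Real.exp (Real.log (oddWieferichExcess q k)) :=
        (Real.exp_log hE0).symm
      have h2 : (q : ℝ) ^ (δ * k) = Real.exp (Real.log q * (δ * k)) := Real.rpow_def_of_pos hq0 _
      rw [h1, h2]
      apply Real.exp_le_exp.mpr
      have : Real.log q * (δ * k) = δ * k * Real.log q := by ring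
      rw [this]
      exact hlog
    calc (oddWieferichExcess q k : ℝ) ≤ (q : ℝ) ^ (δ * k) := hE
      _ = 1 * (q : ℝ) ^ (δ * k) := (one_mul _).symm
      _ < B * (q : ℝ) ^ (δ * k) := mul_lt_mul_of_pos_right hB1 hQ0
  · -- small `k`: `E_W(q,k) ≤ Σ_{j<K₀} E_W < B ≤ B q^(δ k)`
    have hkmem : k ∈ Finset.range K₀ := Finset.mem_range.mpr (by omega)
    have hle : (oddWieferichExcess q k : ℝ) ≤ ∑ j ∈ Finset.range K₀, (oddWieferichExcess q j : ℝ) :=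
      Finset.single_le_sum (fun j _ => Nat.cast_nonneg _) hkmem
    calc (oddWieferichExcess q k : ℝ) ≤ ∑ j ∈ Finset.range K₀, (oddWieferichExcess q j : ℝ) := hle
      _ < B := by rw [hB]; linarith
      _ ≤ B * (q : ℝ) ^ (δ * k) := le_mul_of_one_le_right hB0.le hQ1

end Summit.ABC.ABC.Theorems.PrimePowerRadical.Brjuno

end
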